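import Literature.AlgebraicGeometry.AbelianSchemes.PolarizationSymmetricWitnessOfOnto
import Literature.AlgebraicGeometry.AbelianSchemes.PolarizationOntoGeometricPoints
import HarnessLib

/-!
# A SYMMETRIC ample witness of the polarisation exists at EVERY geometric point — unconditionally over bases locally of finite
# type over a countable field of characteristic zero, and over their base changes (the Siegel pieces)

Layer `Literature/AlgebraicGeometry/AbelianSchemes`, namespaces `Literature.AlgebraicGeometry.AbelianSchemes.AbelianSchemeOver.Polarization`
(§1) and `Literature.AlgebraicGeometry.AbelianSchemes.PolarizedAbelianSchemeWithLevel` (§2).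
THEOREMS ONLY (no definition, no named fact, no instance, no `sorry`).

[MumfordAV1970] §8 Thm. 1 / §8 (iii) with [MumfordFogartyKirwan1994] Def. 6.2–6.3: a polarisation `λ̄ = Λ(𝒪(Θ))` of a `g`-dimensional
abelian variety over an algebraically closed field (`2` invertible) admits an ample SYMMETRIC witness `Θ′` (`(−1)^*Θ′ ∼ Θ′`) —
★ `exists_isAmple_isLambdaOfAt_symmetric_of_onto` (`AbelianSchemes/PolarizationSymmetricWitnessOfOnto`) from «`λ̄_s` onto», and
«`λ̄_s` onto» is ★ `exists_comp_lam_eq_of_dim_hat` / `exists_comp_lam_eq(_baseChange)_of_locallyOfFiniteType`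
(`AbelianSchemes/PolarizationOntoGeometricPoints`: finite kernel + `dim Â_s = dim A_s` ⇒ isogeny).  This file only composes:

* §1 `Polarization.exists_isAmple_isLambdaOfAt_symmetric_of_dim_hat` — at one geometric point, from `dim A_s = dim Â_s`;
* §2 **`PolarizedAbelianSchemeWithLevel.exists_isAmple_isLambdaOfAt_symmetric_of_locallyOfFiniteType`** — for `P = (A, λ, σ)`
  over `S → Spec F` locally of finite type, `F` countable of characteristic `0`, at EVERY geometric point `s` of `S`, binder-free;
  **`…_baseChange_of_locallyOfFiniteType`** — the same for every base change `P ×_S T` (e.g. the universal family pulled back to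
  a smooth piece of `𝓜 ⊗ ℂ`).  `2 ≠ 0` in `Ω` because `Ω` receives the residue field of a point of `S`, of characteristic `0`
  (★ `natCast_ne_zero_of_residueField`, ★ `natCast_residueField_ne_zero_of_charZero`).

Purpose (cell `hodgecm-mathlib`, D-0151; Hecke-link socket (B), (X-amp) hand (h1)): the symmetric `Θ′` at every geometric point
of the Siegel pieces, the input of (X-amp-2) `Θ₀ := φ_d^*Θ′` and of the (X-amp-3) glue ★
`exists_isAmple_isLambdaOfAt_of_symmetric_witnesses`, with NO residual binder.  Count-neutral; HC_CM is proved only modulo the 7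
printed citations until rung 0 closes.

## References
* [MumfordAV1970] D. Mumford, *Abelian Varieties* (1970), §8 Thm. 1 (p. 77), §8 (ii)–(iv) (pp. 74–75).
* [MumfordFogartyKirwan1994] D. Mumford, J. Fogarty, F. Kirwan, *GIT*, 3rd ed. (1994), Ch. 6 §2 Def. 6.2–6.3 (p. 120),
  Ch. 7 §1 Def. 7.1 (p. 129).
-/

set_option autoImplicit false

noncomputable section

universe u

open CategoryTheory CategoryTheory.Limits AlgebraicGeometry Cardinal
open scoped MonObj

namespace Literature.AlgebraicGeometry.AbelianSchemes

open Literature.AlgebraicGeometry.Motives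

namespace AbelianSchemeOver.Polarization

variable {S : Scheme.{u}} {A : AbelianSchemeOver S} {D : A.DualPair} (pol : A.Polarization D) {g : ℕ} {δ : Fin g → ℕ}

/-! ## §1 At one geometric point, from `dim A_s = dim Â_s` -/

/-- **A symmetric ample witness of `λ̄` at a geometric point where `dim A_s = dim Â_s`** (`λ` of type `δ`, `Ω` algebraically
closed with `2 ≠ 0`): `λ̄_s` is an isogeny, hence onto on `Ω`-points (★ `exists_comp_lam_eq_of_dim_hat`), so ★
`exists_isAmple_isLambdaOfAt_symmetric_of_onto` applies. [cite: MumfordAV1970, §8 Thm. 1 (p. 77) and §8 (ii)–(iv) (pp. 74–75)]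
[cite: MumfordFogartyKirwan1994, Ch. 6 §2 Definition 6.2–6.3 (p. 120)] -/
theorem exists_isAmple_isLambdaOfAt_symmetric_of_dim_hat [IsMonHom pol.lam] (hT : pol.HasType δ)
    ⦃Ω : Type u⦄ [Field Ω] [IsAlgClosed Ω] (s : Spec (.of Ω) ⟶ S) (h2 : (2 : Ω) ≠ 0)
    (hdim : (A.fibre s).toAbelianVariety.dim = (D.hat.fibre s).toAbelianVariety.dim) :
    ∃ Θ' : CartierDivisor (A.fibre s).toAbelianVariety.X.left, Θ'.IsAmple ∧ A.IsLambdaOfAt s D pol.lam Θ' ∧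
      (Θ'.classPullback (((𝟙 (A.fibre s).toAbelianVariety.X)⁻¹ :
        (A.fibre s).toAbelianVariety.X ⟶ (A.fibre s).toAbelianVariety.X)).left).LinEquiv Θ' :=
  pol.exists_isAmple_isLambdaOfAt_symmetric_of_onto A s h2 (pol.exists_comp_lam_eq_of_dim_hat hT s hdim)

end AbelianSchemeOver.Polarization

/-! ## §2 Binder-free over bases locally of finite type over a countable field of characteristic zero, and their base changes -/

namespace PolarizedAbelianSchemeWithLevel

open AbelianSchemeOver

variable {S T : Scheme.{0}} {g N : ℕ} {δ : Fin g → ℕ} (P : PolarizedAbelianSchemeWithLevel g N δ S)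
  {F : Type} [Field F] [CharZero F]

/-- **A SYMMETRIC AMPLE WITNESS OF THE POLARISATION AT EVERY GEOMETRIC POINT — UNCONDITIONALLY** for `P = (A, λ, σ)` over a base
`S → Spec F` locally of finite type, `F` countable of characteristic `0` (e.g. the universal family over `𝓜 = 𝒜_{g,δ,N} ⊗ ℚ`):
at every `s : Spec Ω → S` with `Ω` algebraically closed there is an ample `Θ′` on `A_s` with `λ̄ = Λ(𝒪(Θ′))` and `(−1)^*Θ′ ∼ Θ′`
(★ `exists_comp_lam_eq_of_locallyOfFiniteType` ⇒ ★ `exists_isAmple_isLambdaOfAt_symmetric_of_onto`; `2 ≠ 0` in `Ω` from the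
characteristic-`0` residue field under `s`). [cite: MumfordAV1970, §8 Thm. 1 (p. 77) and §8 (ii)–(iv) (pp. 74–75)]
[cite: MumfordFogartyKirwan1994, Ch. 6 §2 Definition 6.2–6.3 (p. 120) and Ch. 7 §1 Definition 7.1 (p. 129)] -/
theorem exists_isAmple_isLambdaOfAt_symmetric_of_locallyOfFiniteType (hF : #F ≤ ℵ₀) (f : S ⟶ Spec (.of F))
    [LocallyOfFiniteType f] ⦃Ω : Type⦄ [Field Ω] [IsAlgClosed Ω] (s : Spec (.of Ω) ⟶ S) :
    ∃ Θ' : CartierDivisor (P.A.fibre s).toAbelianVariety.X.left, Θ'.IsAmple ∧ P.A.IsLambdaOfAt s P.D P.pol.lam Θ' ∧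
      (Θ'.classPullback (((𝟙 (P.A.fibre s).toAbelianVariety.X)⁻¹ :
        (P.A.fibre s).toAbelianVariety.X ⟶ (P.A.fibre s).toAbelianVariety.X)).left).LinEquiv Θ' :=
  P.pol.exists_isAmple_isLambdaOfAt_symmetric_of_onto P.A s
    (natCast_ne_zero_of_residueField s 2 fun x => natCast_residueField_ne_zero_of_charZero f x two_ne_zero)
    (P.exists_comp_lam_eq_of_locallyOfFiniteType hF f s)

/-- **The same for every base change `P ×_S T` along any `w : T → S`** (the universal family pulled back to a piece of the moduli
space over `ℂ`): ★ `exists_comp_lam_eq_baseChange_of_locallyOfFiniteType` feeds ★ `exists_isAmple_isLambdaOfAt_symmetric_of_onto`;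
`2 ≠ 0` in `Ω` through the point `t ≫ w` of `S`. [cite: MumfordAV1970, §8 Thm. 1 (p. 77) and §8 (ii)–(iv) (pp. 74–75)]
[cite: MumfordFogartyKirwan1994, Ch. 6 §2 Definition 6.2–6.3 (p. 120) and Ch. 7 §1 Definition 7.1 (p. 129)] -/
theorem exists_isAmple_isLambdaOfAt_symmetric_baseChange_of_locallyOfFiniteType (hF : #F ≤ ℵ₀) (f : S ⟶ Spec (.of F))
    [LocallyOfFiniteType f] (w : T ⟶ S) ⦃Ω : Type⦄ [Field Ω] [IsAlgClosed Ω] (t : Spec (.of Ω) ⟶ T) :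
    ∃ Θ' : CartierDivisor ((P.baseChange w).A.fibre t).toAbelianVariety.X.left,
      Θ'.IsAmple ∧ (P.baseChange w).A.IsLambdaOfAt t (P.baseChange w).D (P.baseChange w).pol.lam Θ' ∧
      (Θ'.classPullback (((𝟙 ((P.baseChange w).A.fibre t).toAbelianVariety.X)⁻¹ :
        ((P.baseChange w).A.fibre t).toAbelianVariety.X ⟶ ((P.baseChange w).A.fibre t).toAbelianVariety.X)).left).LinEquiv Θ' :=
  (P.baseChange w).pol.exists_isAmple_isLambdaOfAt_symmetric_of_onto (P.baseChange w).A t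
    (natCast_ne_zero_of_residueField (t ≫ w) 2 fun x => natCast_residueField_ne_zero_of_charZero f x two_ne_zero)
    (P.exists_comp_lam_eq_baseChange_of_locallyOfFiniteType hF f w t)

end PolarizedAbelianSchemeWithLevel

end Literature.AlgebraicGeometry.AbelianSchemes

end
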